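import Literature.Analysis.FunctionSpaces.LittlewoodPaleyHolderHeat
import HarnessLib

/-!
# A quantitative smooth representative of the low-frequency part `Ṡ₀ u` (Schauder program, item A′4(a))

Topic `Literature/Analysis/FunctionSpaces`. Quantitative twin of
`exists_smooth_rep_lowFreqCutoff_zero` (`LittlewoodPaleyHolderHeat.lean`), in the shape of
`exists_smooth_rep_lpBlock`: there are constants `A₀ m ≥ 0` and `C₀ < ∞` such that for every
tempered distribution `u` with `Ṡ₀ u ∈ L^∞` the low-frequency part `Ṡ₀ u` is the distribution of a
smooth function `g₀` with

  `‖Dᵐ g₀(x)‖ ≤ A₀ m · (C₀ ‖Ṡ₀ u‖_{L^∞})`   for all `m`, `x`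

(`Ṡ₀ u = e^{Δ}(Θ₀(D) Ṡ₀ u)`, `Θ₀(D)` bounded on `L^∞` by Young's inequality, heat smoothing bounds
at time `1`; Triebel 1983, 2.5.7 Step 1). This is the low-frequency input of the quantitative
Besov → Hölder estimate (A′4(b)) behind the constant-coefficient Schauder estimate, census item
(2a) of `Literature.Geometry.Riemannian.gurskyViaclovsky_pathOpen_weighted_four`. Everything is
proved; no named facts.

## References

* H. Triebel, *Theory of Function Spaces* (1983), 2.5.7. [Triebel1983]
-/

noncomputable section

open MeasureTheory FourierTransform SchwartzMap Real Filter Topology Function TemperedDistribution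
open scoped SchwartzMap ENNReal NNReal FourierTransform RealInnerProductSpace ContDiff

namespace Literature.Analysis.FunctionSpaces

variable {E : Type*} [NormedAddCommGroup E] [InnerProductSpace ℝ E] [FiniteDimensional ℝ E]
  [MeasurableSpace E] [BorelSpace E] {F : Type*} [NormedAddCommGroup F] [NormedSpace ℂ F]
  [CompleteSpace F]

/-- **Quantitative smooth representative of `Ṡ₀ u`.** There are `A₀ : ℕ → ℝ` (nonnegative) and
`C₀ < ∞` such that for every `u ∈ 𝓢'(E, F)` with `‖Ṡ₀ u‖_{L^∞} < ∞` there is a smooth `g₀` with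
`‖Dᵐ g₀(x)‖ ≤ A₀ m · (C₀ ‖Ṡ₀ u‖_{L^∞}).toReal` for all `m, x`, essentially bounded and representing
`Ṡ₀ u`. [cite: Triebel1983, Prop. 2.5.7/(2) Step 1] -/
theorem exists_smooth_rep_lowFreqCutoff_zero_quant :
    ∃ (A₀ : ℕ → ℝ) (C₀ : ℝ≥0∞), (∀ m, 0 ≤ A₀ m) ∧ C₀ < ⊤ ∧
      ∀ (u : 𝓢'(E, F)), eLpNormDistrib ∞ (lowFreqCutoff 0 u) < ⊤ →
        ∃ g : E → F, ContDiff ℝ (⊤ : ℕ∞) g ∧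
          (∀ (m : ℕ) (x : E), ‖iteratedFDeriv ℝ m g x‖ ≤
            A₀ m * (C₀ * eLpNormDistrib ∞ (lowFreqCutoff 0 u)).toReal) ∧
          ∃ hg : MemLp g ∞ (volume : Measure E),
            ((hg.toLp g : Lp F ∞ (volume : Measure E)) : 𝓢'(E, F)) = lowFreqCutoff 0 u := by
  have hΘ := contDiff_hasCompactSupport_lowHeatSymbol (E := E)
  set Θ : 𝓢(E, ℂ) := hΘ.2.toSchwartzMap hΘ.1 with hΘdef
  have hΘcoe : (Θ : E → ℂ) = fun ξ : E => (Real.exp ((2 * π) ^ 2 * ‖ξ‖ ^ 2) : ℂ) * lowFreqSymbol 1 ξ := rfl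
  -- the constants
  choose A hA0 hA using fun m => exists_norm_iteratedFDeriv_heatExtension_coe_le (E := E) (F := F) m
  set C₀ : ℝ≥0∞ := max (eLpNorm (⇑(𝓕⁻ Θ : 𝓢(E, ℂ))) 1 volume) 1 with hC₀
  have hC₀top : C₀ < ⊤ := max_lt ((𝓕⁻ Θ).eLpNorm_lt_top 1 volume) ENNReal.one_lt_top
  refine ⟨A, C₀, hA0, hC₀top, fun u hu => ?_⟩
  -- `w = Θ₀(D) Ṡ₀ u ∈ L^∞` with `‖w‖ ≤ C₀ ‖Ṡ₀ u‖`
  have hwle : eLpNormDistrib ∞ (fourierMultiplierCLM F (Θ : E → ℂ) (lowFreqCutoff 0 u)) ≤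
      C₀ * eLpNormDistrib ∞ (lowFreqCutoff 0 u) :=
    eLpNormDistrib_fourierMultiplierCLM_le Θ (lowFreqCutoff 0 u)
  have hwfin : eLpNormDistrib ∞ (fourierMultiplierCLM F (Θ : E → ℂ) (lowFreqCutoff 0 u)) < ⊤ :=
    hwle.trans_lt (ENNReal.mul_lt_top hC₀top hu)
  obtain ⟨w, hw⟩ := exists_coe_eq_of_eLpNormDistrib_lt_top hwfin
  have hwnorm : ‖w‖ ≤ (C₀ * eLpNormDistrib ∞ (lowFreqCutoff 0 u)).toReal := by
    have h1 : ‖w‖ₑ ≤ C₀ * eLpNormDistrib ∞ (lowFreqCutoff 0 u) := by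
      rw [← eLpNormDistrib_coe w, hw]
      exact hwle
    rw [← toReal_enorm]
    exact ENNReal.toReal_mono (ENNReal.mul_ne_top hC₀top.ne hu.ne) h1
  have hmem : MemLp (UnboundedOperators.heatExtension (w : E → F) 1) ∞ (volume : Measure E) :=
    UnboundedOperators.memLp_heatExtension_holds (Lp.memLp w) le_top one_pos
  refine ⟨UnboundedOperators.heatExtension (w : E → F) 1,
    UnboundedOperators.contDiff_heatExtension_holds (Lp.memLp w) le_top one_pos, fun m x => ?_, hmem, ?_⟩
  · have h := hA m one_pos w x
    rw [Real.one_rpow, mul_one] at h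
    exact h.trans (mul_le_mul_of_nonneg_left hwnorm (hA0 m))
  · rw [lowFreqCutoff_zero_eq_heatSemigroup_fourierMultiplierCLM u, ← hΘcoe, ← hw,
      Lp.heatSemigroup_toTemperedDistribution_Lp_holds UnboundedOperators.memLp_heatExtension_holds w one_pos]

end Literature.Analysis.FunctionSpaces

end
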